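import Summits.Ventures.Crystal3D.Theorems.StickyWulffConstantGenericWallFloorStarFarCheck
import HarnessLib

/-!
# Kernel discharge of `StarPairFar`, part 4: soundness of the discharge tests

HONEST FRAMING. Venture `Summits/Ventures/Crystal3D` (cell `crystal3d-full`), helper `--supports` the crux
`GenericWallFloor` (stmt-Ventures-19480) of `route-Ventures-StickyWulffConstant`, line `WallLedgerG`.  Rung credit only;
F-C1 not moved.  The SEMANTICS of the branch and bound of part 3, for a real quaternion `q = (w,x,y,z)` (a point of a
q-box) and a real scaled eleventh ball `s = SC·Y` (a point of a Y-box), all in the `× √2` cubic frame: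
`Sph` (`|Y|² = 2`), `H1` (the stars `F`, `M·F` are `1`-separated up to coincidence, `M = N(q)/|q|²`), `H3`/`H4` (`Y` is at
distance `≥ 1` from the ten star balls), `Ball c` (the ball inequality of certificate `c`:
`6 − 2·Σ B_ab M_ab + [useY]·|Y − y₀|² < 1/Ktot`), `Goal` (`Sph → H1 → H3 → H4 → ∃ c ∈ starDtCerts, Ball c`); and the
soundness of the four Y-tests and the two q-tests: `qBasic_sound`, `yClosed_sound` (every discharged box consists of
points satisfying `Goal`).  The searches and tasks are treated in part 5.
-/

namespace Summit.Ventures.Crystal3D.Theorems.StarFar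

open Summit.Ventures.Crystal3D.Theorems.NearIdentity

/-! ### Semantics -/

/-- `|q|²`. -/
noncomputable def nrm (w x y z : ℝ) : ℝ := w ^ 2 + x ^ 2 + y ^ 2 + z ^ 2

/-- The scaled eleventh ball lies on the sphere `|Y|² = 2`. -/
def Sph (s0 s1 s2 : ℝ) : Prop := s0 * s0 + s1 * s1 + s2 * s2 = 2 * (SC : ℝ) * SC

/-- h1★: every (fixed star ball, moving star ball) pair coincides (`Fᵢᵀ N Fⱼ = 2|q|²`) or is `1`-separated
(`Fᵢᵀ N Fⱼ ≤ |q|²`, i.e. `|Fᵢ − M Fⱼ|² ≥ 2`). -/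
def H1 (w x y z : ℝ) : Prop :=
  ∀ i ∈ starIdx, ∀ j ∈ starIdx, FNF i j w x y z = 2 * nrm w x y z ∨ FNF i j w x y z ≤ nrm w x y z

/-- h3★: `Y ⬝ Fᵢ ≤ 1` for every fixed star ball (`|Y − Fᵢ|² ≥ 2`). -/
def H3 (s0 s1 s2 : ℝ) : Prop := ∀ i ∈ starIdx, (FZ i 0 : ℝ) * s0 + FZ i 1 * s1 + FZ i 2 * s2 ≤ SC

/-- h4★: `Y ⬝ (M Fⱼ) ≤ 1` for every moving star ball (`|Y − M Fⱼ|² ≥ 2`). -/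
def H4 (w x y z s0 s1 s2 : ℝ) : Prop :=
  ∀ j ∈ starIdx, NF j 0 w x y z * s0 + NF j 1 w x y z * s1 + NF j 2 w x y z * s2 ≤ SC * nrm w x y z

/-- The ball of certificate `c` contains `(M, Y)`: `6 − 2·Σ_ab B_ab M_ab + [useY]·|Y − y₀|² < 1/Ktot`
(`‖M − B‖_F² = 6 − 2 tr(Bᵀ M)` for orthogonal `M`, `B`). -/
def Ball (c : DTCert) (w x y z s0 s1 s2 : ℝ) : Prop :=
  6 - 2 * (∑ a : Fin 3, ∑ b : Fin 3, ((c.B a b : ℚ) : ℝ) * quatMat w x y z a b) / nrm w x y z +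
      (if c.useY then
        (s0 / SC - ((c.y0 0 : ℚ) : ℝ)) ^ 2 + (s1 / SC - ((c.y0 1 : ℚ) : ℝ)) ^ 2 + (s2 / SC - ((c.y0 2 : ℚ) : ℝ)) ^ 2
      else 0) < 1 / ((c.Ktot : ℚ) : ℝ)

/-- What the branch and bound certifies at a point. -/
def Goal (w x y z s0 s1 s2 : ℝ) : Prop :=
  Sph s0 s1 s2 → H1 w x y z → H3 s0 s1 s2 → H4 w x y z s0 s1 s2 → ∃ c ∈ starDtCerts, Ball c w x y z s0 s1 s2

/-! ### Algebraic helpers -/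

/-- The scale: positive, and equal to `2³²`. -/
theorem SC_spec : (0 : ℝ) < SC ∧ ((SC : ℤ) : ℝ) = 2 ^ 32 := by unfold SC; norm_num

/-- `|q|²` with products instead of squares. -/
theorem nrm_eq (w x y z : ℝ) : nrm w x y z = w * w + x * x + y * y + z * z := by unfold nrm; ring

/-- `Fᵢᵀ N Fⱼ = Σ_a Fᵢ_a (N Fⱼ)_a`. -/
theorem FNF_eq (i j : Fin 13) (w x y z : ℝ) :
    FNF i j w x y z = (FZ i 0 : ℝ) * NF j 0 w x y z + FZ i 1 * NF j 1 w x y z + FZ i 2 * NF j 2 w x y z := by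
  simp only [FNF, NF, Fin.sum_univ_three]; ring

/-- `Ktot = Kn / Kd` over `ℝ`. -/
theorem ktot_cast (c : DTCert) : ((c.Ktot : ℚ) : ℝ) = (c.Ktot.num : ℝ) / (c.Ktot.den : ℝ) := by
  exact_mod_cast (Rat.num_div_den c.Ktot).symm

/-- The ball inequality without eleventh ball from the sign of `E_c`. -/
theorem ball_ineq0 {n S Kn Kd : ℝ} (hn : 0 < n) (hKn : 0 < Kn) (h : Kn * (6 * n - 2 * S) < Kd * n) :
    6 - 2 * S / n + 0 < 1 / (Kn / Kd) := by
  have hn' := hn.ne'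
  have hKn' := hKn.ne'
  have key : 1 / (Kn / Kd) - (6 - 2 * S / n + 0) = (Kd * n - Kn * (6 * n - 2 * S)) / (Kn * n) := by
    field_simp
    ring
  have hpos : 0 < (Kd * n - Kn * (6 * n - 2 * S)) / (Kn * n) := div_pos (by linarith) (by positivity)
  linarith

/-- The ball inequality with eleventh ball from the CERTY test. -/
theorem ball_ineq {n S D Kn Kd T : ℝ} (hn : 0 < n) (hKn : 0 < Kn) (hT : 0 < T)
    (h : Kn * (6 * n - 2 * S) * T ^ 2 + Kn * D * n < Kd * n * T ^ 2) :
    6 - 2 * S / n + D / T ^ 2 < 1 / (Kn / Kd) := by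
  have hn' := hn.ne'
  have hKn' := hKn.ne'
  have hT' := hT.ne'
  have key : 1 / (Kn / Kd) - (6 - 2 * S / n + D / T ^ 2) =
      (Kd * n * T ^ 2 - (Kn * (6 * n - 2 * S) * T ^ 2 + Kn * D * n)) / (Kn * n * T ^ 2) := by
    field_simp
  have hpos : 0 < (Kd * n * T ^ 2 - (Kn * (6 * n - 2 * S) * T ^ 2 + Kn * D * n)) / (Kn * n * T ^ 2) :=
    div_pos (by linarith) (by positivity)
  linarith

/-- The arithmetic of the CERTY test: enclosures in, ball inequality out. -/
theorem certy_arith {n S D e U nhi Kn Kd T : ℝ} (hn : 0 < n) (hKn : 0 < Kn) (hT : 0 < T)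
    (hE : 3 * (Kn * (6 * n - 2 * S) - Kd * n) ≤ U) (hDe : D ≤ e) (hD0 : 0 ≤ D) (hnn : n ≤ nhi)
    (hlt : U * (T * T) + 3 * Kn * e * nhi < 0) : 6 - 2 * S / n + D / T ^ 2 < 1 / (Kn / Kd) := by
  have i1 : 3 * Kn * D * n ≤ 3 * Kn * e * n :=
    mul_le_mul_of_nonneg_right (mul_le_mul_of_nonneg_left hDe (by linarith)) hn.le
  have i2 : 3 * Kn * e * n ≤ 3 * Kn * e * nhi :=
    mul_le_mul_of_nonneg_left hnn (by nlinarith [hD0, hDe, hKn])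
  have i3 : 3 * (Kn * (6 * n - 2 * S) - Kd * n) * (T * T) ≤ U * (T * T) :=
    mul_le_mul_of_nonneg_right hE (mul_pos hT hT).le
  have key : Kn * (6 * n - 2 * S) * T ^ 2 + Kn * D * n < Kd * n * T ^ 2 := by nlinarith
  exact ball_ineq hn hKn hT key

/-- `certOK` for every listed certificate, from `allCertOK`. -/
theorem certOK_of_mem (hOK : allCertOK = true) {c : DTCert} (hc : c ∈ starDtCerts) : certOK c = true := by
  rw [allCertOK, List.all_eq_true] at hOK
  exact hOK c hc

/-! ### Soundness of the q-level tests -/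

/-- **PAIR / CERTQ soundness**: every real point of a q-box discharged by `qBasic` satisfies `Goal` (for every `Y`). -/
theorem qBasic_sound (hOK : allCertOK = true) {B : Box4} (hB : qBasic B = true) {w x y z : ℝ}
    (hx : B.Mem w x y z) (hn : 0 < nrm w x y z) (s0 s1 s2 : ℝ) : Goal w x y z s0 s1 s2 := by
  intro _ h1 _ _
  rw [qBasic, Bool.or_eq_true, List.any_eq_true, List.any_eq_true] at hB
  rcases hB with ⟨p, hp, hpt⟩ | ⟨E, hE, hEt⟩
  · -- PAIR: hypothesis h1★ fails at every point of the box
    exfalso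
    rw [pairForms, List.mem_map] at hp
    obtain ⟨⟨i, j⟩, hij, rfl⟩ := hp
    rw [starPairs, List.mem_flatMap] at hij
    obtain ⟨i', hi', hj⟩ := hij
    rw [List.mem_map] at hj
    obtain ⟨j', hj', hp⟩ := hj
    simp only [Prod.mk.injEq] at hp
    have hi : i ∈ starIdx := (mem_starList_iff i).1 (hp.1 ▸ hi')
    have hj : j ∈ starIdx := (mem_starList_iff j).1 (hp.2 ▸ hj')
    rw [Bool.and_eq_true, decide_eq_true_eq, decide_eq_true_eq] at hpt
    have hA := (QF4.range_sound (pairA i j) B hx).1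
    have hC := (QF4.range_sound (pairC i j) B hx).1
    rw [pairA_eval] at hA
    rw [pairC_eval] at hC
    have hA0 : (0 : ℝ) < (pairA i j).lo B := by exact_mod_cast hpt.1
    have hC0 : (0 : ℝ) < (pairC i j).lo B := by exact_mod_cast hpt.2
    rcases h1 i hi j hj with h | h
    · rw [nrm] at h; linarith
    · rw [nrm] at h; linarith
  · -- CERTQ: the ball of a `useY = false` certificate contains the box
    rw [certQForms, List.mem_map] at hE
    obtain ⟨c, hc, rfl⟩ := hE
    rw [List.mem_filter] at hc
    obtain ⟨hc, huse⟩ := hc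
    have huse' : c.useY = false := by simpa using huse
    have hck := certOK_of_mem hOK hc
    obtain ⟨-, -, hK, -⟩ := certOK_spec hck
    refine ⟨c, hc, ?_⟩
    rw [decide_eq_true_eq] at hEt
    have hE := (QF4.range_sound (certE c) B hx).2
    rw [certE_eval hck] at hE
    have hE0 : (((certE c).hi B : ℤ) : ℝ) < 0 := by exact_mod_cast hEt
    have hKn : (0 : ℝ) < c.Ktot.num := by exact_mod_cast Rat.num_pos.2 hK
    unfold Ball
    rw [if_neg (by simp [huse']), ktot_cast, nrm]
    exact ball_ineq0 (by rw [nrm] at hn; exact hn) hKn (by nlinarith)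

/-! ### Soundness of the Y-level tests -/

/-- The sphere `|Y|² = 2` lies in the root Y-box `[−3/2, 3/2]³`. -/
theorem rootY_mem {s0 s1 s2 : ℝ} (hs : Sph s0 s1 s2) : rootY.Mem s0 s1 s2 := by
  have hS := SC_spec.1
  unfold Sph at hs
  have h0 : s0 * s0 ≤ 2 * SC * SC := by nlinarith
  have h1 : s1 * s1 ≤ 2 * SC * SC := by nlinarith
  have h2 : s2 * s2 ≤ 2 * SC * SC := by nlinarith
  have hb : ((3 * 2 ^ 31 : ℤ) : ℝ) = 3 / 2 * SC := by unfold SC; push_cast; ring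
  refine ⟨?_, ?_, ?_⟩ <;> simp only [rootY, Int.cast_zero, sub_zero] <;> rw [hb, abs_le] <;>
    constructor <;> nlinarith

/-- **SPHERE / FIX / MOV / CERTY soundness**: every real point `(q, Y)` of q-box × Y-box with the Y-box discharged by
`yClosed` satisfies `Goal`. -/
theorem yClosed_sound (hOK : allCertOK = true) {B : Box4} {Y : Box3} (hcl : yClosed (mkCtx B) Y = true)
    {w x y z : ℝ} (hx : B.Mem w x y z) (hn : 0 < nrm w x y z) {s0 s1 s2 : ℝ} (hy : Y.Mem s0 s1 s2) :
    Goal w x y z s0 s1 s2 := by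
  intro hs h1 h3 h4
  have hS := SC_spec.1
  rw [yClosed, Bool.or_eq_true, Bool.or_eq_true, Bool.or_eq_true] at hcl
  rcases hcl with ((hc | hc) | hc) | hc
  · -- SPHERE
    exfalso
    have hq := Y.sq_sound hy
    unfold Sph at hs
    rw [ySphere, Bool.or_eq_true, decide_eq_true_eq, decide_eq_true_eq] at hc
    rcases hc with hc | hc
    · have : (2 * SC * SC : ℝ) < (Y.sqLo : ℝ) := by exact_mod_cast hc
      linarith [hq.1]
    · have : ((Y.sqHi : ℤ) : ℝ) < 2 * SC * SC := by exact_mod_cast hc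
      linarith [hq.2]
  · -- FIX
    exfalso
    rw [yFix, List.any_eq_true] at hc
    obtain ⟨f, hf, hft⟩ := hc
    rw [fixVecs, List.mem_map] at hf
    obtain ⟨i, hi, rfl⟩ := hf
    rw [decide_eq_true_eq] at hft
    have hl := Y.linLo_sound (FZ i 0) (FZ i 1) (FZ i 2) hy
    have : (SC : ℝ) < (Y.linLo (FZ i 0) (FZ i 1) (FZ i 2) : ℝ) := by exact_mod_cast hft
    have h3i := h3 i ((mem_starList_iff i).1 hi)
    linarith
  · -- MOV
    exfalso
    rw [yMov, List.any_eq_true] at hc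
    obtain ⟨m, hm, hmt⟩ := hc
    simp only [mkCtx, List.mem_map] at hm
    obtain ⟨f, hf, rfl⟩ := hm
    rw [movForms, List.mem_map] at hf
    obtain ⟨j, hj, rfl⟩ := hf
    rw [decide_eq_true_eq] at hmt
    have hnhi := (B.sq_sound hx).2
    have r0 := QF4.range_sound (movF j 0) B hx
    have r1 := QF4.range_sound (movF j 1) B hx
    have r2 := QF4.range_sound (movF j 2) B hx
    rw [movF_eval] at r0 r1 r2
    obtain ⟨m0, m1, m2⟩ := hy
    have p0 := prodLo_sound r0 m0
    have p1 := prodLo_sound r1 m1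
    have p2 := prodLo_sound r2 m2
    have hlt : ((B.sqHi * SC : ℤ) : ℝ) <
        ((prodLo ((movF j 0).lo B) ((movF j 0).hi B) Y.c0 Y.h0 +
          prodLo ((movF j 1).lo B) ((movF j 1).hi B) Y.c1 Y.h1 +
          prodLo ((movF j 2).lo B) ((movF j 2).hi B) Y.c2 Y.h2 : ℤ) : ℝ) := by exact_mod_cast hmt
    push_cast at hlt
    have h4j := h4 j ((mem_starList_iff j).1 hj)
    rw [nrm_eq] at h4j
    have hsn : (SC : ℝ) * (w * w + x * x + y * y + z * z) ≤ SC * (B.sqHi : ℝ) :=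
      mul_le_mul_of_nonneg_left hnhi hS.le
    linarith
  · -- CERTY
    rw [yCert, List.any_eq_true] at hc
    obtain ⟨r, hr, hrt⟩ := hc
    simp only [mkCtx, List.mem_map] at hr
    obtain ⟨f, hf, rfl⟩ := hr
    rw [cyForms, List.mem_map] at hf
    obtain ⟨c, hc, rfl⟩ := hf
    rw [List.mem_filter] at hc
    obtain ⟨hc, huse⟩ := hc
    have hck := certOK_of_mem hOK hc
    obtain ⟨-, hy0, hK, -⟩ := certOK_spec hck
    refine ⟨c, hc, ?_⟩
    rw [decide_eq_true_eq] at hrt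
    dsimp only at hrt
    have hKn : (0 : ℝ) < c.Ktot.num := by exact_mod_cast Rat.num_pos.2 hK
    -- the enclosures over the q-box
    have hE := (QF4.range_sound (certE c) B hx).2
    rw [certE_eval hck, ← nrm] at hE
    have hnr := (B.sq_sound hx).2
    rw [← nrm_eq] at hnr
    -- the distance enclosure over the Y-box
    obtain ⟨m0, m1, m2⟩ := hy
    have e0 := (sq_range_sound (Y.c0 - SC * (c.y0 0).num) Y.h0 (t := s0 - SC * ((c.y0 0 : ℚ) : ℝ))
      (by push_cast; rw [hy0 0]; rwa [show s0 - (SC : ℝ) * ((c.y0 0 : ℚ) : ℝ) - (Y.c0 - SC * ((c.y0 0 : ℚ) : ℝ)) =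
        s0 - Y.c0 by ring])).2
    have e1 := (sq_range_sound (Y.c1 - SC * (c.y0 1).num) Y.h1 (t := s1 - SC * ((c.y0 1 : ℚ) : ℝ))
      (by push_cast; rw [hy0 1]; rwa [show s1 - (SC : ℝ) * ((c.y0 1 : ℚ) : ℝ) - (Y.c1 - SC * ((c.y0 1 : ℚ) : ℝ)) =
        s1 - Y.c1 by ring])).2
    have e2 := (sq_range_sound (Y.c2 - SC * (c.y0 2).num) Y.h2 (t := s2 - SC * ((c.y0 2 : ℚ) : ℝ))
      (by push_cast; rw [hy0 2]; rwa [show s2 - (SC : ℝ) * ((c.y0 2 : ℚ) : ℝ) - (Y.c2 - SC * ((c.y0 2 : ℚ) : ℝ)) =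
        s2 - Y.c2 by ring])).2
    have hlt : (((certE c).hi B * (SC * SC) + 3 * c.Ktot.num *
        (sqHi (Y.c0 - SC * (c.y0 0).num) Y.h0 + sqHi (Y.c1 - SC * (c.y0 1).num) Y.h1 +
          sqHi (Y.c2 - SC * (c.y0 2).num) Y.h2) * B.sqHi : ℤ) : ℝ) < 0 := by exact_mod_cast hrt
    push_cast at hlt
    have hfin := certy_arith hn hKn hS hE (by linarith [e0, e1, e2] :
        (s0 - SC * ((c.y0 0 : ℚ) : ℝ)) * (s0 - SC * ((c.y0 0 : ℚ) : ℝ)) +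
        (s1 - SC * ((c.y0 1 : ℚ) : ℝ)) * (s1 - SC * ((c.y0 1 : ℚ) : ℝ)) +
        (s2 - SC * ((c.y0 2 : ℚ) : ℝ)) * (s2 - SC * ((c.y0 2 : ℚ) : ℝ)) ≤ _)
      (add_nonneg (add_nonneg (mul_self_nonneg _) (mul_self_nonneg _)) (mul_self_nonneg _)) hnr hlt
    unfold Ball
    rw [if_pos (by simpa using huse), ktot_cast]
    have hS' := hS.ne'
    have hY : (s0 / SC - ((c.y0 0 : ℚ) : ℝ)) ^ 2 + (s1 / SC - ((c.y0 1 : ℚ) : ℝ)) ^ 2 +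
        (s2 / SC - ((c.y0 2 : ℚ) : ℝ)) ^ 2 =
        ((s0 - SC * ((c.y0 0 : ℚ) : ℝ)) * (s0 - SC * ((c.y0 0 : ℚ) : ℝ)) +
        (s1 - SC * ((c.y0 1 : ℚ) : ℝ)) * (s1 - SC * ((c.y0 1 : ℚ) : ℝ)) +
        (s2 - SC * ((c.y0 2 : ℚ) : ℝ)) * (s2 - SC * ((c.y0 2 : ℚ) : ℝ))) / (SC : ℝ) ^ 2 := by
      field_simp
    rw [hY]
    exact hfin

end Summit.Ventures.Crystal3D.Theorems.StarFar
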